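import Literature.NumberTheory.EllipticCurves.EmertonPollackWeston2006.HidaFamilyTransfer
import HarnessLib

/-!
# Emerton–Pollack–Weston 2006 at an ODD prime, the (multiplicative, good-ordinary) PAIR of weight-two
# members of `H(ρ̄)`: Cor. 5.1.4 / Thm. 5.1.3 (good ordinary ⟶ multiplicative, odd `p`) and Theorem 1
# (`∗ = alg`, `∗ = an`, multiplicative ⟶ good ordinary, odd `p`) — three named facts

Topic `NumberTheory/EllipticCurves`, sub-directory `EmertonPollackWeston2006` (namespace = path). THREE
named facts (`def … : Prop`, D-0014; nothing asserted; no `_holds` — size XL: Hida theory for `ρ̄`, the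
two-variable algebraic and analytic `p`-adic `L`-functions of EPW §§2–4, Kato [KKT]); the bookkeeping
(`…_odd ⟹` the `5 ≤ p` fact) is proved on the consumer side. Companion of
* `HidaFamilyTransfer.lean` — `cor514_transfer_of_goodOrdinary` / `cor514_transfer_of_multiplicative`
  (Cor. 5.1.4 with Thm. 5.1.3, transcribed at `5 ≤ p`; its module docstring: "`p` odd — NARROWER here:
  `5 ≤ p` (the cell uses the fact at `p ≥ 5` only …)" and "`-- TODO(general form): … the reverse direction
  multiplicative → good`"), whose two SHAPES `GoodOrdinaryCharIdealMuZero` / `MultiplicativeCharIdealMuZero`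
  and whose bridges (Greenberg vs classical Selmer group; canonical vs Néron period) are reused VERBATIM;
* `MuAnTransferGoodOrdinary.lean` — `thm1_muAn_transfer_of_torsionIso_odd` (Theorem 1, `∗ = an`, two GOOD
  ordinary curves, print strength "odd `p`", appended 2026-08-26);
* `MuAnTransferMultiplicative.lean` — `thm1_muAn_transfer_mult_of_goodOrdinary` /
  `thm1_muAn_transfer_mult_of_multiplicative` (Theorem 1, `∗ = an`, TARGET multiplicative, `5 ≤ p`);
* `WeightKMembersOddPrime.lean` — the weight-`k > 2` member instances at an odd prime (`…_odd`).
This file adds what none of them states: the odd-prime (so `p = 3`) form of the good-ordinary ⟶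
multiplicative main-conjecture transfer, and Theorem 1 in BOTH halves read FROM the multiplicative member
TO the good-ordinary one. Consumer: the BSD cell `bsd-print-x11a` / `bsd-stepL`, crux `X11aLowerHalf`
(item stmt-BirchSwinnertonDyer-19064) at `p = 3`, where the rank-`0` curve `E` has `3 ‖ N`, `E[3]`
irreducible and NO auxiliary ramified prime, and a `3`-congruent GOOD ORDINARY partner `A` (available
exactly when `E[3]|_{G_{ℚ₃}}` is finite flat) carries the rational main conjecture of Yan–Zhu 2026
(`YanZhu2026.thm49_charIdeal_eq_padicLFunction`, `p > 2`): `μ^alg`, `μ^an` move from `E` to `A` by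
Theorem 1, the integral identity with `μ = 0` at `A` follows, and Cor. 5.1.4 moves it back to `E`.
HONEST FRAMING: nothing here proves BSD for any curve; named facts are hypotheses consumers take by name.

## The printed statements (Invent. Math. 163 (2006) 523–580 = arXiv:math/0404484; held text
`paper:arxiv-math_0404484`, chunk∕line locators of that materialisation)

* Intro, chunk p0002 L3–L13: "Let `ρ̄ : G_ℚ → GL₂(k)` be an absolutely irreducible modular Galois
  representation over a finite field `k` of characteristic `p`. Assume further that `ρ̄` is `p`-ordinary
  and `p`-distinguished … The Hida family `H(ρ̄)` of `ρ̄` is the set of all `p`-ordinary `p`-stabilized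
  newforms `f` with mod `p` Galois representation isomorphic to `ρ̄`."
* **Theorem 1** (chunk p0002 L33–L37, verbatim): "Fix `∗ ∈ {alg, an}`. If `μ^∗(f₀) = 0` for some
  `f₀ ∈ H(ρ̄)`, then `μ^∗(f) = 0` for all `f ∈ H(ρ̄)`."
* §1 Notation (chunk p0005 L39): "We fix an odd prime `p`"; §2.6 (chunk p0013 L89–L91): "`ρ̄` is
  `p`-distinguished if furthermore the characters `χ` and `ψ` [the diagonal characters of `ρ̄|_{G_p}`] are
  distinct."
* **Theorem 3.1.1** (chunk p0017 L82–L86): "Let `f` be a `p`-ordinary and `p`-stabilized newform with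
  `ρ̄_f` absolutely irreducible. Then `Sel(ℚ_∞, A_{f,i})` is co-finitely generated, `Λ_𝒪`-cotorsion …";
  §3.1 (chunk p0017): "`μ^alg(f,ω^i)` … the largest power of `π` dividing … the characteristic power
  series of the `Λ_𝒪`-dual of `Sel(ℚ_∞, A_{f,i})`".
* **Theorem 5.1.2 (Kato)** / **Theorem 5.1.3** / **Corollary 5.1.4** (chunk p0030 L41–L93, verbatim):
  "There is a `u ∈ Λ_𝒪 ⊗ ℚ_p` such that `L_p^alg(f,ω^i) · u = L_p^an(f,ω^i)`. …" / "Let … `ρ̄ : G_ℚ →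
  GL₂(k)` be an irreducible, modular, `p`-ordinary and `p`-distinguished representation; as always we fix a
  choice of `p`-stabilization. Suppose that `μ^alg(f₀,ω^i) = μ^an(f₀,ω^i) = 0` and `λ^alg(f₀,ω^i) =
  λ^an(f₀,ω^i)` for some `f₀` in the Hida family attached to `ρ̄` and some `i`. Then `μ^alg(f,ω^i) =
  μ^an(f,ω^i) = 0` and `λ^alg(f,ω^i) = λ^an(f,ω^i)` for every `f` in the Hida family attached to `ρ̄`." /
  "Let `ρ̄` be as above and suppose that `μ^alg(ρ̄,ω^i) = μ^an(ρ̄,ω^i) = 0` for some `i`. If the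
  [MC] holds for `f₀ ⊗ ω^i` for one form `f₀` in the Hida family of `ρ̄`, then the [MC] holds for
  `f ⊗ ω^i` for every form `f` in the Hida family of `ρ̄`." ([MC] = EPW's statement 5.1.1
  `L_p^alg · u = L_p^an`, `u ∈ Λ_𝒪^×`; elided name because of the docstring lint, as in
  `HidaFamilyTransfer.lean`.)
* `p` IN THE LEVEL — Example 5.3.1 (chunk p0032 L22 ff.): the weight-two newform of `X₀(11)` at `p = 11`
  (split multiplicative) is a member of its Hida family, its `μ^an`/`λ^an` read on the Mazur–Tate–
  Teitelbaum function `L_p^an(f,T)`, and Cor. 5.1.4 is applied to it; Example 5.3.2 (chunk p0033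
  L16–L30): two congruent elliptic curves (`52a`, `364a`, `p = 5`), the [MC] passes from `E₁` to `E₂`.

## The prime `3` (why these transcriptions say "`p ≠ 2`" where `HidaFamilyTransfer.lean` says "`5 ≤ p`")

EPW fix "an odd prime `p`" (Notation, chunk p0005) and never exclude `3`; the sibling's `5 ≤ p` was a
deliberate narrowing ("the cell uses the fact at `p ≥ 5` only"). The one place where `3` needs a word is
EPW's Thm. 2.1.2 (chunk p0006 L93–L112: "`𝕋_N` is free of finite rank over `Λ` … Proof. See [hida1], and
[hida2]"), Hida's 1986 papers being printed for `p ≥ 5`. For the reader at `p = 3`: the freeness ∕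
control of the ordinary Hecke algebra over `Λ` is refereed print at EVERY prime in H. Hida, *Elementary
Modular Iwasawa Theory* (World Scientific 2022), Thm. 4.2.37 — the locator settled by the tree's D-audit
of record for the same question (`YanZhu2026/CyclotomicMainTheoremIntegral.lean`, module docstring,
"gap width settled at the page: `Λ_D`-projectivity/control is refereed print at every `p` by Hida (2022)
Thm. 4.2.37"). The hypotheses on `ρ̄` hold at `p = 3` exactly as at `p ≥ 5`: `E[3]` irreducible and odd
⟹ absolutely irreducible (complex conjugation has the distinct eigenvalues `±1`; Cornell–Silverman–Stevens
1997 p. 218, printed for `p = 3`); at the multiplicative curve `ρ̄|_{G_{ℚ₃}}` is the Tate extension of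
`δ` by `δω` (`δ` unramified, `δ² = 1`), reducible, non-scalar and RAMIFIED since `ω|_{I₃} ≠ 1` — so
`p`-ordinary, `p`-distinguished, and no unramified line has to be fixed; the same `ρ̄` at the good-ordinary
partner. Cell flag for the referee (statement-level grade unchanged; not a claim that anything is false):
`EPW06@3-Hida-control` — "EPW Thm. 2.1.2 cites Hida 1986 (`p ≥ 5`); at `p = 3` read Hida 2022 Thm.
4.2.37". Precedent in the tree for the odd-prime reading of EPW: `WeightKMembersOddPrime.lean` (p612190,
referee V29 PASS) and `thm1_muAn_transfer_of_torsionIso_odd` (x10 GEN 37).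

## Transcription and bridges (weaker than print, never stronger)

`W₁, W₂/ℚ` globally minimal elliptic curves (`[IsElliptic] [IsGloballyMinimal]`), `p ≠ 2`, a
`Γ_ℚ`-equivariant additive isomorphism of `p`-torsion (`geomTorsion`), irreducibility of the `p`-torsion
of the FIRST curve (transported to the second along the isomorphism,
`GreenbergVatsal2000.hasIrreducibleModPGaloisRep_of_torsionIso`). The weight-two members: for a curve GOOD
ORDINARY at `p` (`HasGoodReductionAtPrime`, `p ∤ a_p`) the `p`-stabilisation `f^{(α)}` of its newform
(`U_p`-eigenvalue the unit root `α = unitRoot W p`); for a curve MULTIPLICATIVE at `p`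
(`HasMultiplicativeReductionAtPrime`) its newform itself (tame level `N/p`, `U_p = a_p = ±1`; Ex. 5.3.1).
* "`μ^alg(f) = 0`" at an elliptic-curve member `f = f_W` — "`X(W/ℚ_∞)` is `Λ`-torsion with `μ = 0`":
  for the cyclotomic data `(κ, γ)` (`IsCyclotomic`, `IsTopGenerator`, `IsCyclotomicVariable`) and every
  Pontryagin-dual datum `D : W.SelmerDualData κ γ` of the classical `Sel_{p^∞}(W/ℚ_∞)`, `D.IsTorsion ∧
  D.mu = 0` — BYTE-IDENTICAL to the hypothesis "`μ^alg(f_E) = 0`" of `thm1_muAlg_of_weightK_member_ofLevel(_odd)`.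
  Bridge: EPW's `Sel(ℚ_∞, A_f)` is Greenberg's Selmer group of `ρ_f` with its ordinary line; for `f = f_W`
  at a GOOD ordinary `p` it IS the classical Selmer group (Greenberg, LNM 1716 (1999), Props. 2.2–2.4:
  "`Im(κ_v) = Im(λ_v)`"), at `p ‖ N` it contains the classical one with quotient of corank `e ≤ 1`
  (`e = 1` iff split; Skinner, Pacific J. Math. 283 (2016) §3.2: "`Ch_L(f) = Ch_L(f)' · (γ − 1)`"), so
  `L_p^alg(f_W) ∼ T^e ·`(classical generator) and the `μ`-invariants agree (`μ(T^e g) = μ(g)`,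
  `hasUnitContent_X_mul_iff`). The torsion conjunct of a CONCLUSION is Thm. 3.1.1 (the classical dual is a
  quotient of the cotorsion Greenberg dual).
* "`μ^an(f) = 0`" — at a GOOD ordinary curve: byte-identical to the clause of
  `thm1_muAn_transfer_of_torsionIso(_odd)` (for every newform `f` of `W` at level `N_W` and every rational
  `ϖ` with `ϖ·Ω_W = Ω⁺_f`, some coefficient of `ϖ · padicLFunction f α` is a `p`-adic unit); at a
  MULTIPLICATIVE curve: byte-identical to the body of the BSD cell's typed certificate
  `Summit.BirchSwinnertonDyer.Rank1Residual.X11a.MuAnZeroAt` and to the hypothesis of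
  `thm1_muAn_transfer_mult_of_multiplicative` (for every newform `f` of `W`, `IsNewformOf W f`, any level,
  and every `ϖ` with `ϖ·Ω_W = Ω⁺_f`: a unit coefficient of `ϖ·L` for THE non-split Mazur–Tate–Teitelbaum
  function `IsMultPAdicLFunctionOf f p (-1) L` at a non-split `p`, THE split one
  `IsSplitMultPAdicLFunctionOf f p L` at a split `p`; the trivial zero `T ∣ L` at a split `p` does not
  affect `μ`). Bridge (canonical period of Prop. 4.1.4 vs Néron period): for irreducible `E[p]` at an ODD
  `p` of good or multiplicative reduction they differ by a `p`-adic unit — Greenberg–Vatsal, Invent. Math.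
  142 (2000) §3 Prop. (3.1) ("all odd primes `p` of either good or multiplicative reduction"), Remark
  (3.4), Prop. (3.7); Mazur 1978 Cor. 4.1 (Manin constant at an odd `p` with `p² ∤ N`); Skinner 2016 §3.3
  — the SAME bridge as the audited `cor514_transfer_of_goodOrdinary` (R33.4) and as
  `thm1_muAn_transfer_of_torsionIso_odd` (GV Prop. (3.7) is printed for odd `p`).
* "[MC] with `μ = 0`" — the two SHAPES of `HidaFamilyTransfer.lean`, unchanged:
  `GoodOrdinaryCharIdealMuZero W p` (source) and `MultiplicativeCharIdealMuZero W p` (target).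
So every Lean hypothesis implies the printed hypothesis and every Lean conclusion is the printed conclusion
in the tree's normalisation; `p = 2`, reducible `E[p]`, additive curves, higher weight and `ω^i`-twists
are excluded, exactly or more narrowly than in the source.

## References

* M. Emerton, R. Pollack, T. Weston, Invent. Math. 163 (2006) 523–580, Thm. 1 (p. 524 = arXiv p. 2),
  §1 Notation (p. 5), Thm. 2.1.2 (p. 6), §2.6 (p. 13), §3.1 + Thm. 3.1.1 (p. 17), Prop. 4.1.4 (p. 21),
  §5.1 (statement 5.1.1, Thm. 5.1.2, Thm. 5.1.3, Cor. 5.1.4; p. 30), Ex. 5.3.1–5.3.2 (pp. 32–33).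
  [EmertonPollackWeston2006]
* H. Hida, *Elementary Modular Iwasawa Theory* (World Scientific, 2022), Thm. 4.2.37 (control at every `p`).
* R. Greenberg, V. Vatsal, Invent. Math. 142 (2000) 17–63, §3: Prop. (3.1), Remark (3.4), Prop. (3.7).
  [GreenbergVatsal2000]
* R. Greenberg, LNM 1716 (1999), §2 Props. 2.1–2.4, Thm. 1.5. [GreenbergLNM1716]
* C. Skinner, Pacific J. Math. 283 (2016) 171–200, §2 (odd `p`), §3.2, §3.3. [Skinner2016PacificMC]
* B. Mazur, Invent. Math. 44 (1978), Cor. 4.1. [Mazur1978]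
* G. Cornell, J. Silverman, G. Stevens (eds.), *Modular Forms and Fermat's Last Theorem* (1997), p. 218.
-/

noncomputable section

open scoped Classical MatrixGroups ModularForm

open CongruenceSubgroup WeierstrassCurve Literature.NumberTheory.EllipticCurves
  Literature.NumberTheory.EllipticCurves.ModularForms Literature.NumberTheory.EllipticCurves.Rank1Residual
  Literature.NumberTheory.EllipticCurves.GreenbergVatsal2000

namespace Literature.NumberTheory.EllipticCurves.EmertonPollackWeston2006

/-! ### Cor. 5.1.4 / Thm. 5.1.3, good ordinary ⟶ multiplicative, at an ODD prime -/

/-- **Emerton–Pollack–Weston 2006, Cor. 5.1.4 with Thm. 5.1.3 (source: good ordinary; target: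
multiplicative) at an ODD prime `p`** — the print-strength form of `cor514_transfer_of_goodOrdinary`
(`HidaFamilyTransfer.lean`): VERBATIM that statement with its binder `5 ≤ p` replaced by the printed
"odd prime `p`" (Invent. Math. 163 (2006), §1 Notation p. 5, held text chunk p0005 L39: "We fix an odd
prime `p`"), nothing else changed. Cor. 5.1.4 (arXiv:math/0404484 p. 30, chunk p0030 L87–L93): "Let `ρ̄`
be as above [irreducible, modular, `p`-ordinary and `p`-distinguished; fixed `p`-stabilization] and
suppose that `μ^alg(ρ̄,ω^i) = μ^an(ρ̄,ω^i) = 0` for some `i`. If the [MC] holds for `f₀ ⊗ ω^i` for one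
form `f₀` in the Hida family of `ρ̄`, then the [MC] holds for `f ⊗ ω^i` for every form `f` in the Hida
family of `ρ̄`"; Thm. 5.1.3 (chunk p0030 L60–L80) for the `μ = 0` clause of the conclusion; Thm. 3.1.1
(chunk p0017 L82–L86) for its torsion clause; `H(ρ̄)` (p. 2) contains the weight-two newform of a curve
with `p ‖ N` (Ex. 5.3.1, p. 32) and the `p`-stabilised newform of a good ordinary curve (Ex. 5.3.2, p. 33).
TRANSCRIPTION (module docstring §Transcription), `i = 0`, `f₀ = f_{E₁}^{(α)}`, `f = f_{E₂}`: `W₁, W₂/ℚ`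
globally minimal elliptic, `p ≠ 2`, `E₁` GOOD ORDINARY at `p` (`HasGoodReductionAtPrime`, `p ∤ a_p`),
`E₂` MULTIPLICATIVE at `p`, a `Γ_ℚ`-equivariant additive isomorphism `E₁[p] ≃ E₂[p]`, `E₁[p]` irreducible
(⟹ absolutely irreducible, `p`-ordinary, `p`-distinguished, ramified at `p` — at `p = 3` too, module
docstring §The prime 3); HYPOTHESIS `GoodOrdinaryCharIdealMuZero W₁ p` (= "[MC] for `f₀`" + "`μ^alg =
μ^an = 0`" at `f₀`, Greenberg–Vatsal / Néron normalisation); CONCLUSION `MultiplicativeCharIdealMuZero W₂ p`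
(Cor. 5.1.4 + Thm. 5.1.3's `μ`-clause + Thm. 3.1.1's torsion clause for `f`, read through Skinner 2016
§3.2 — the factor `T` exactly at a split `p` — and §3.3 — canonical vs Néron period a `ℤ_(p)^×`-multiple
for irreducible `E[p]`, `ord_p N ≤ 1`, odd `p`; Greenberg–Vatsal 2000 §3 Prop. (3.1), Remark (3.4)).
At `p = 3` the Hida-theoretic input of EPW's Thm. 2.1.2 is read in Hida (2022) Thm. 4.2.37 (flag
`EPW06@3-Hida-control`, module docstring). The `5 ≤ p` fact is this one restricted
(bookkeeping on the consumer side, `5 ≤ p ⟹ p ≠ 2`). Named fact; nothing asserted; users take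
`(h : cor514_transfer_of_goodOrdinary_odd)`.
-- TODO(general form): Cor. 5.1.4 for every pair of members of H(ρ̄) (weights k ≥ 2, twists ω^i,
-- 𝒪-coefficients, any tame levels); only (weight 2, good ordinary) → (weight 2, p ‖ N) is here.
[cite: EmertonPollackWeston2006, Cor. 5.1.4, Thm. 5.1.3, Thm. 5.1.2, statement 5.1.1 (arXiv:math/0404484 p. 30, held text `paper:arxiv-math_0404484` chunk p0030 L41–L93); Thm. 3.1.1 and §3.1 (p. 17, chunk p0017 L82–L86); §1 Notation (p. 5, chunk p0005 L39: odd p); Thm. 2.1.2 (p. 6); §2.6 (p. 13, chunk p0013 L89–L91); Prop. 4.1.4 (p. 21); Intro p. 2; Ex. 5.3.1–5.3.2 (pp. 32–33)]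
[cite: Skinner2016PacificMC, §2 (odd p), §3.2 (arXiv:1407.1093 p0014 L12–L40) and §3.3 (p0016 L14–L50)]
[cite: GreenbergVatsal2000, §3, Prop. (3.1), Remark (3.4), Prop. (3.7) (arXiv:math/9906215 pp. 34–39)]
[cite: GreenbergLNM1716, §2 Props. 2.1–2.4 and §3 PDF p. 91] -/
def cor514_transfer_of_goodOrdinary_odd : Prop :=
  ∀ (W₁ W₂ : WeierstrassCurve ℚ) [W₁.IsElliptic] [W₁.IsGloballyMinimal]
    [W₂.IsElliptic] [W₂.IsGloballyMinimal] (p : ℕ) [Fact p.Prime],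
    p ≠ 2 →
    W₁.HasGoodReductionAtPrime p → ¬ (p : ℤ) ∣ W₁.frobeniusTrace p →
    W₂.HasMultiplicativeReductionAtPrime p →
    (∃ e : geomTorsion W₁ (p : ℤ) ≃+ geomTorsion W₂ (p : ℤ),
      ∀ (σ : Field.absoluteGaloisGroup ℚ) (P : geomTorsion W₁ (p : ℤ)), e (σ • P) = σ • e P) →
    W₁.HasIrreducibleModPGaloisRep p →
    GoodOrdinaryCharIdealMuZero W₁ p → MultiplicativeCharIdealMuZero W₂ p

/-! ### Theorem 1, multiplicative ⟶ good ordinary, at an ODD prime (`∗ = alg` and `∗ = an`) -/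

/-- **Emerton–Pollack–Weston 2006, Theorem 1 with `∗ = alg` (and Thm. 3.1.1 for cotorsion): from a
curve MULTIPLICATIVE at an odd `p` to a mod-`p` congruent curve GOOD ORDINARY at `p`.** Invent. Math. 163
(2006), Theorem 1 (arXiv:math/0404484 p. 2, held text chunk p0002 L33–L37, verbatim): "Fix
`∗ ∈ {alg, an}`. If `μ^∗(f₀) = 0` for some `f₀ ∈ H(ρ̄)`, then `μ^∗(f) = 0` for all `f ∈ H(ρ̄)`"; Thm.
3.1.1 (p. 17, chunk p0017 L82–L86): "Let `f` be a `p`-ordinary and `p`-stabilized newform with `ρ̄_f`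
absolutely irreducible. Then `Sel(ℚ_∞, A_{f,i})` is co-finitely generated, `Λ_𝒪`-cotorsion …"; `H(ρ̄)`
(p. 2, chunk p0002 L3–L13) contains the weight-two newform of a curve with `p ‖ N` (Ex. 5.3.1, p. 32)
and the `p`-stabilised newform of a good ordinary curve (Ex. 5.3.2, p. 33); "We fix an odd prime `p`"
(§1 p. 5, chunk p0005 L39). TRANSCRIPTION (`∗ = alg`, `i = 0`; module docstring §Transcription):
`W₁, W₂/ℚ` globally minimal elliptic, `p ≠ 2`, `W₁` MULTIPLICATIVE at `p` (source `f₀ = f_{W₁}`), `W₂`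
GOOD ORDINARY at `p` (`HasGoodReductionAtPrime`, `p ∤ a_p`; target `f = f_{W₂}^{(α)}`), a
`Γ_ℚ`-equivariant additive isomorphism `W₁[p] ≃ W₂[p]`, `W₁[p]` irreducible (⟹ `ρ̄` absolutely
irreducible, `p`-ordinary, `p`-distinguished, also at `p = 3`: module docstring §The prime 3);
HYPOTHESIS "`μ^alg(f_{W₁}) = 0`" and CONCLUSION "`μ^alg(f_{W₂}^{(α)}) = 0`", BOTH in the shape
"for the cyclotomic data `(κ, γ)` and every dual datum `D` of the classical `Sel_{p^∞}(W/ℚ_∞)`: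
`D.IsTorsion ∧ D.mu = 0`" — byte-identical to the hypothesis "`μ^alg(f_E) = 0`" of
`thm1_muAlg_of_weightK_member_ofLevel_odd` (`WeightKMembersOddPrime.lean`). Bridges: Greenberg's Selmer
group of EPW §3.1 vs the classical one — equal at the good ordinary `W₂` (Greenberg LNM 1716 Props.
2.2–2.4), quotient of corank `≤ 1` at `p ‖ N_{W₁}` (Skinner 2016 §3.2), so the `μ`-invariants are the
classical ones on both sides; the torsion conjunct of the conclusion is Thm. 3.1.1 ([Kato], [KKT]). At
`p = 3` EPW's Thm. 2.1.2 is read in Hida (2022) Thm. 4.2.37 (flag `EPW06@3-Hida-control`). Weaker than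
print (two weight-two members, one direction, `∗ = alg`), never stronger. Named fact; nothing asserted;
users take `(h : thm1_muAlg_transfer_goodOrdinary_of_mult_odd)`.
-- TODO(general form): Theorem 1 for every pair of members of H(ρ̄) (all weights, twists ω^i, 𝒪-coefficients).
[cite: EmertonPollackWeston2006, Thm. 1 (arXiv:math/0404484 p. 2, held text `paper:arxiv-math_0404484` chunk p0002 L33–L37), Intro p. 2 (H(ρ̄), chunk p0002 L3–L13), §1 p. 5 (chunk p0005 L39: odd p), Thm. 2.1.2 (p. 6), §2.6 (p. 13), §3.1 and Thm. 3.1.1 (p. 17, chunk p0017 L82–L86), Ex. 5.3.1–5.3.2 (pp. 32–33)]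
[cite: GreenbergLNM1716, §2 Props. 2.1–2.4, Thm. 1.5]
[cite: Skinner2016PacificMC, §2 (odd p) and §3.2 (arXiv:1407.1093 p0014 L12–L40)] -/
def thm1_muAlg_transfer_goodOrdinary_of_mult_odd : Prop :=
  ∀ (W₁ W₂ : WeierstrassCurve ℚ) [W₁.IsElliptic] [W₁.IsGloballyMinimal]
    [W₂.IsElliptic] [W₂.IsGloballyMinimal] (p : ℕ) [Fact p.Prime],
    p ≠ 2 →
    W₁.HasMultiplicativeReductionAtPrime p →
    W₂.HasGoodReductionAtPrime p → ¬ (p : ℤ) ∣ W₂.frobeniusTrace p →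
    (∃ e : geomTorsion W₁ (p : ℤ) ≃+ geomTorsion W₂ (p : ℤ),
      ∀ (σ : Field.absoluteGaloisGroup ℚ) (P : geomTorsion W₁ (p : ℤ)), e (σ • P) = σ • e P) →
    W₁.HasIrreducibleModPGaloisRep p →
    -- `μ^alg(f_{W₁}) = 0`
    (∀ (κ : ZpExtension ℚ p) (γ : Field.absoluteGaloisGroup ℚ), κ.IsCyclotomic →
        κ.IsTopGenerator γ → IsCyclotomicVariable p γ →
        ∀ D : W₁.SelmerDualData κ γ, D.IsTorsion ∧ D.mu = 0) →
    -- `μ^alg(f_{W₂}^{(α)}) = 0`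
    ∀ (κ : ZpExtension ℚ p) (γ : Field.absoluteGaloisGroup ℚ), κ.IsCyclotomic →
        κ.IsTopGenerator γ → IsCyclotomicVariable p γ →
        ∀ D : W₂.SelmerDualData κ γ, D.IsTorsion ∧ D.mu = 0

/-- **Emerton–Pollack–Weston 2006, Theorem 1 with `∗ = an` (Thm. 4.4.5): from a curve MULTIPLICATIVE
at an odd `p` to a mod-`p` congruent curve GOOD ORDINARY at `p`** — the reverse direction of
`thm1_muAn_transfer_mult_of_goodOrdinary` (`MuAnTransferMultiplicative.lean`, `5 ≤ p`) at print strength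
"odd `p`". Theorem 1 (arXiv:math/0404484 p. 2, chunk p0002 L33–L37, verbatim): "Fix `∗ ∈ {alg, an}`.
If `μ^∗(f₀) = 0` for some `f₀ ∈ H(ρ̄)`, then `μ^∗(f) = 0` for all `f ∈ H(ρ̄)`"; `H(ρ̄)` (p. 2, chunk
p0002 L3–L13); the `p`-new weight-two member (Ex. 5.3.1, p. 32: `X₀(11)` at `p = 11`, "`μ^an(f) = 0`"
read on the Mazur–Tate–Teitelbaum function `L_p^an(f,T)`); "We fix an odd prime `p`" (§1 p. 5, chunk
p0005 L39). TRANSCRIPTION (`∗ = an`; module docstring §Transcription): `W₁, W₂/ℚ` globally minimal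
elliptic, `p ≠ 2`, `W₁` MULTIPLICATIVE at `p` (source), `W₂` GOOD ORDINARY at `p` (`HasGoodReductionAtPrime`,
`p ∤ a_p`; target), a `Γ_ℚ`-equivariant additive isomorphism `W₁[p] ≃ W₂[p]`, `W₁[p]` irreducible;
HYPOTHESIS "`μ^an(f_{W₁}) = 0`" byte-identical to the body of the BSD cell's typed certificate
`Summit.BirchSwinnertonDyer.Rank1Residual.X11a.MuAnZeroAt W₁ p` and to the hypothesis of
`thm1_muAn_transfer_mult_of_multiplicative` (a unit coefficient of `ϖ₁·L` for THE non-split function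
`IsMultPAdicLFunctionOf f₁ p (-1) L` at a non-split `p` ∕ THE split one `IsSplitMultPAdicLFunctionOf f₁ p L`
at a split `p`; every newform `f₁` of `W₁`, every `ϖ₁` with `ϖ₁·Ω_{W₁} = Ω⁺_{f₁}`); CONCLUSION
"`μ^an(f_{W₂}^{(α)}) = 0`" byte-identical to the conclusion of `thm1_muAn_transfer_of_torsionIso_odd`
(some coefficient of `ϖ₂ · padicLFunction f₂ (unitRoot W₂ p)` is a `p`-adic unit, for every newform `f₂`
of `W₂` at level `N_{W₂}` and every `ϖ₂` with `ϖ₂·Ω_{W₂} = Ω⁺_{f₂}`). Canonical (Prop. 4.1.4) vs Néron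
period a `p`-adic unit under (irr) at an ODD `p` of good or multiplicative reduction: Greenberg–Vatsal
2000 §3 Prop. (3.1) ("all odd primes `p` of either good or multiplicative reduction"), Remark (3.4),
Prop. (3.7); Mazur 1978 Cor. 4.1; Skinner 2016 §3.3 — the bridge of the audited
`cor514_transfer_of_goodOrdinary` and of `thm1_muAn_transfer_of_torsionIso_odd`. At `p = 3` EPW's Thm.
2.1.2 is read in Hida (2022) Thm. 4.2.37 (flag `EPW06@3-Hida-control`). Weaker than print (two
weight-two members, one direction, `∗ = an`), never stronger. Named fact; nothing asserted; users take
`(h : thm1_muAn_transfer_goodOrdinary_of_mult_odd)`.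
-- TODO(general form): Theorem 1 for every pair of members of H(ρ̄) (all weights, twists ω^i), and ∗ = alg via canonical periods.
[cite: EmertonPollackWeston2006, Thm. 1 (arXiv:math/0404484 p. 2, held text `paper:arxiv-math_0404484` chunk p0002 L33–L37), Intro p. 2 (H(ρ̄), chunk p0002 L3–L13), §1 p. 5 (chunk p0005 L39: odd p), Thm. 2.1.2 (p. 6), §2.6 (p. 13), Prop. 4.1.4 (p. 21), Thm. 4.4.5 (p. 24), Ex. 5.3.1 (p. 32, chunk p0032 L22 ff.)]
[cite: GreenbergVatsal2000, §3, Prop. (3.1), Remark (3.4), Prop. (3.7) (arXiv:math/9906215 pp. 34–39)]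
[cite: Mazur1978, Cor. 4.1]
[cite: Skinner2016PacificMC, §2 (odd p) and §3.3 (arXiv:1407.1093 p0016 L14–L50)] -/
def thm1_muAn_transfer_goodOrdinary_of_mult_odd : Prop :=
  ∀ (W₁ W₂ : WeierstrassCurve ℚ) [W₁.IsElliptic] [W₁.IsGloballyMinimal]
    [W₂.IsElliptic] [W₂.IsGloballyMinimal] (p : ℕ) [Fact p.Prime],
    p ≠ 2 →
    W₁.HasMultiplicativeReductionAtPrime p →
    W₂.HasGoodReductionAtPrime p → ¬ (p : ℤ) ∣ W₂.frobeniusTrace p →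
    (∃ e : geomTorsion W₁ (p : ℤ) ≃+ geomTorsion W₂ (p : ℤ),
      ∀ (σ : Field.absoluteGaloisGroup ℚ) (P : geomTorsion W₁ (p : ℤ)), e (σ • P) = σ • e P) →
    W₁.HasIrreducibleModPGaloisRep p →
    -- `μ^an(f_{W₁}) = 0` (the shape `X11a.MuAnZeroAt W₁ p`)
    (∀ {N : ℕ} [NeZero N] (f₁ : CuspForm (Gamma0 N) 2), IsNewformOf W₁ f₁ →
      ∀ (ϖ₁ : ℚ), (ϖ₁ : ℝ) * W₁.realPeriodRat = plusPeriod f₁ →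
        (¬ W₁.HasSplitMultiplicativeReductionAtPrime p →
          ∀ L : PowerSeries ℚ_[p], IsMultPAdicLFunctionOf f₁ p (-1) L →
            ∃ n : ℕ, ‖PowerSeries.coeff n (PowerSeries.C ((ϖ₁ : ℚ) : ℚ_[p]) * L)‖ = 1) ∧
        (W₁.HasSplitMultiplicativeReductionAtPrime p →
          ∀ L : PowerSeries ℚ_[p], IsSplitMultPAdicLFunctionOf f₁ p L →
            ∃ n : ℕ, ‖PowerSeries.coeff n (PowerSeries.C ((ϖ₁ : ℚ) : ℚ_[p]) * L)‖ = 1)) →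
    -- `μ^an(f_{W₂}^{(α)}) = 0` (Néron-normalised, as in `thm1_muAn_transfer_of_torsionIso_odd`)
    ∀ [NeZero (W₂.conductorNorm ℤ)] (f₂ : CuspForm (Gamma0 (W₂.conductorNorm ℤ)) 2),
        IsNewformOf W₂ f₂ → ∀ (ϖ₂ : ℚ), (ϖ₂ : ℝ) * W₂.realPeriodRat = plusPeriod f₂ →
      ∃ n : ℕ, ‖PowerSeries.coeff n
        (PowerSeries.C (ϖ₂ : ℚ_[p]) * padicLFunction f₂ (unitRoot W₂ p : ℚ_[p]))‖ = 1

end Literature.NumberTheory.EllipticCurves.EmertonPollackWeston2006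

end
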